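import Literature.AlgebraicGeometry.Resolution.ArithmeticalThreefoldsHeadReduction
import Literature.AlgebraicGeometry.Resolution.ArithmeticalThreefoldsDensity512
import HarnessLib

/-!
# Cossart–Piltant 2019, Prop. 4.8: (LU) for `A` from the final state of Lemma 4.7

Topic: `Literature/AlgebraicGeometry/Resolution` (proofs only; no new notions, no new named
facts). Continuation of `ArithmeticalThreefoldsHeadReduction.lean`
(`exists_adjoin_isRegularLocalRing_of_headData`: (LU) for `A` at `v` from the data (511)–(512))
and `ArithmeticalThreefoldsDensity512.lean` ((512) by density). In the proof of Cossart–Piltant's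
descent from the formal completion (V. Cossart, O. Piltant, *Resolution of singularities of
arithmetical threefolds*, J. Algebra 529 (2019) 268–535 = arXiv:1412.0868, journal Prop. 4.8 =
arXiv v1 Prop. 4.6, pp. 52–53), once the extension `v̂` of `v` to the formal branch `K̂₁` is chosen
and Lemma 4.7 (= [CoP1] Prop. 8.1) has been run, the situation is: a regular local ring
`S = 𝒪_{Ŷ,ŷ}` essentially of finite type over `Â`, dominated by `v̂`, with a regular system of
parameters `(û₁, …, û_r, x_{r+1}, …, x_d)` such that `m_A S ⊆ (û₁ ⋯ û_r)`
(`√(m_Â 𝒪_{Ŷ,ŷ}) = (û₁ ⋯ û_r)`), the elements `f₁, …, f_r ∈ A` with `ℚ`-independent values being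
units times monomials in `û₁, …, û_r`, and — by the construction (510) of the model (its
generators have denominators dividing a power of `g ∣ h`, i.e. monomials in the `ûᵢ` times units)
— each complementary parameter `x_i` reached by an element `b_i ∈ Â` of the shape
`unit · monomial(û) · x_i`. This file PROVES that these data already give (LU) for `A` at `v`:

* `exists_adjoin_isRegularLocalRing_of_lemma47State` — (511)
  (`CossartPiltantMonomial.exists_prod_zpow_eq_units_mul_pow`), (512) by density
  (`exists_rsp_powers_of_cp511_of_shape`) and the end of the proof
  (`exists_adjoin_isRegularLocalRing_of_headData`: `T = ` integral closure of `A[g₁, …, g_d]`,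
  EGA IV 7.9.3.1, `𝒪_{Ŷ,ŷ} = T'_{P'}`).

What is NOT here (the remaining content of the geometric head): the model `S` itself with its
denominator clause (journal Prop. 4.6 / Thm. 1.1 (ii) for `Spec Â`) and the run of Lemma 4.7
(`head_conclusion_of_principalized_within'`) producing `û`, the monomial `fᵢ` and
`m_A S ⊆ (û₁ ⋯ û_r)`.

## Sources

* V. Cossart, O. Piltant, J. Algebra 529 (2019) 268–535 = arXiv:1412.0868, proof of Prop. 4.8
  with Lemma 4.7 and (510)–(512) (arXiv v1: Prop. 4.6, pp. 52–53). [CossartPiltant2019]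
-/

noncomputable section

namespace Literature.AlgebraicGeometry.Resolution

universe u

open IsLocalRing

section Lemma47State

variable {A : Type u} [CommRing A] [IsDomain A] [IsLocalRing A] [IsNoetherianRing A]
  {K : Type u} [Field K] [Algebra A K] [IsFractionRing A K]

/-- **(LU) for `A` at `v` from the final state of Lemma 4.7 and the shape elements of (510).**
Let `A` be a Noetherian local domain essentially of finite type over a field `k` with fraction
field `K`; `K̂₁` a field under `Â` with kernel a minimal prime and `K̂₁ = QF(Â/P̂₁)`; `ι : K → K̂₁`
compatible with `A → Â`; `O'` a valuation ring of `K̂₁` with residue field algebraic over that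
of `Â` and `O' ∩ K = O`; `S` a regular local ring essentially of finite type over `Â` by a local
homomorphism, embedded in `K̂₁` over `Â`, contained in and dominated by `O'`. Suppose `𝔪_S` is
generated by nonzero `u₁, …, u_r` (`r ≥ 1`) and `x₁, …, x_e` with `m_A S ⊆ (u₁ ⋯ u_r)`; suppose
given `f₁, …, f_r ∈ K` whose images are `γ_i ∏_k u_k^{e_{ik}}` (`γ_i ∈ Sˣ`) with multiplicatively
independent `v`-values (in the source `f_i ∈ A`, `v(f_i)` `ℚ`-linearly independent, and Lemma
4.7: `√(h𝒪_{Ŷ,ŷ}) = √(m_Â 𝒪_{Ŷ,ŷ}) = (û₁ ⋯ û_r)`), and, for each `i`, an element `b_i ∈ Â`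
whose image in `S` is `ε_i (∏_j u_j^{m_{ij}}) x_i`, `ε_i ∈ Sˣ` (from (510)). Then some finitely
generated `A[t] ⊆ O` is regular at the centre of `O` — (LU) for `A` at `v`. Proof: (511), (512)
by density of `A` in `Â`, and `exists_adjoin_isRegularLocalRing_of_headData`.
[cite: CossartPiltant2019, proof of Prop. 4.8 with Lemma 4.7 and (510)–(512) (arXiv v1: Prop. 4.6, pp. 52–53)] -/
theorem exists_adjoin_isRegularLocalRing_of_lemma47State
    (k : Type u) [Field k] [Algebra k A] [Algebra.EssFiniteType k A]
    {K₁ : Type u} [Field K₁] [Algebra (AdicCompletion (maximalIdeal A) A) K₁]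
    (hP₁ : RingHom.ker (algebraMap (AdicCompletion (maximalIdeal A) A) K₁) ∈
      minimalPrimes (AdicCompletion (maximalIdeal A) A))
    (hK₁ : ∀ z : K₁, ∃ a b : AdicCompletion (maximalIdeal A) A,
      z = algebraMap _ K₁ a / algebraMap _ K₁ b)
    (ι : K →+* K₁) (hι : ι.comp (algebraMap A K) =
      (algebraMap (AdicCompletion (maximalIdeal A) A) K₁).comp
        (algebraMap A (AdicCompletion (maximalIdeal A) A)))
    (O' : ValuationSubring K₁)
    (halgO' : ∀ y : O', ∃ p : Polynomial (AdicCompletion (maximalIdeal A) A),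
      (∃ i, p.coeff i ∉ (maximalIdeal A).map (algebraMap A (AdicCompletion (maximalIdeal A) A))) ∧
      O'.valuation (p.eval₂ (algebraMap (AdicCompletion (maximalIdeal A) A) K₁) y) < 1)
    (O : ValuationSubring K) (hO : O'.comap ι = O)
    -- the model
    {S : Type u} [CommRing S] [IsRegularLocalRing S]
    [Algebra (AdicCompletion (maximalIdeal A) A) S]
    [IsLocalHom (algebraMap (AdicCompletion (maximalIdeal A) A) S)]
    [Algebra.EssFiniteType (AdicCompletion (maximalIdeal A) A) S] [Algebra S K₁]
    [IsScalarTower (AdicCompletion (maximalIdeal A) A) S K₁]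
    (hSK₁ : Function.Injective (algebraMap S K₁))
    (hSO' : ∀ s : S, algebraMap S K₁ s ∈ O')
    (hdomS : ∀ s ∈ maximalIdeal S, O'.valuation (algebraMap S K₁ s) < 1)
    -- the final state of Lemma 4.7
    {r e : ℕ} (hr : 0 < r) (u : Fin r → S) (hu0 : ∀ j, u j ≠ 0) (x : Fin e → S)
    (hspan : Ideal.span (Set.range u ∪ Set.range x) = maximalIdeal S)
    (hq : ∀ a ∈ maximalIdeal A, algebraMap (AdicCompletion (maximalIdeal A) A) S
      (algebraMap A (AdicCompletion (maximalIdeal A) A) a) ∈ Ideal.span {∏ j, u j})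
    (f : Fin r → K) (γ : Fin r → Sˣ) (expo : Fin r → Fin r → ℕ)
    (hf : ∀ i, ι (f i) = algebraMap S K₁ (γ i * ∏ j, u j ^ expo i j))
    (hind : ∀ n : Fin r → ℤ, ∏ i, O.valuation (f i) ^ n i = 1 → n = 0)
    -- the shape elements of (510)
    (bsh : Fin e → AdicCompletion (maximalIdeal A) A) (ε : Fin e → Sˣ) (m : Fin e → Fin r → ℕ)
    (hbsh : ∀ i, algebraMap _ S (bsh i) = ε i * (∏ j, u j ^ m i j) * x i) :
    ∃ (t : Finset K) (h : (Algebra.adjoin A (t : Set K)).toSubring ≤ O.toSubring),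
      IsRegularLocalRing (Localization.AtPrime
        (Ideal.comap (Subring.inclusion h) (maximalIdeal O))) := by
  classical
  haveI : IsDomain S := isDomain_of_isRegularLocalRing S
  -- the `A`-algebra structures on `K̂₁`, `S` and the `K`-algebra structure on `K̂₁` given by `ι`
  letI : Algebra A K₁ := ((algebraMap (AdicCompletion (maximalIdeal A) A) K₁).comp
    (algebraMap A (AdicCompletion (maximalIdeal A) A))).toAlgebra
  haveI : IsScalarTower A (AdicCompletion (maximalIdeal A) A) K₁ :=
    IsScalarTower.of_algebraMap_eq fun _ => rfl
  letI : Algebra K K₁ := ι.toAlgebra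
  have hιK : ∀ y : K, algebraMap K K₁ y = ι y := fun _ => rfl
  haveI : IsScalarTower A K K₁ :=
    IsScalarTower.of_algebraMap_eq fun y => (RingHom.congr_fun hι y).symm
  letI : Algebra A S := ((algebraMap (AdicCompletion (maximalIdeal A) A) S).comp
    (algebraMap A (AdicCompletion (maximalIdeal A) A))).toAlgebra
  haveI : IsScalarTower A (AdicCompletion (maximalIdeal A) A) S :=
    IsScalarTower.of_algebraMap_eq fun _ => rfl
  haveI : IsScalarTower A S K₁ := IsScalarTower.of_algebraMap_eq fun y => by
    change (algebraMap (AdicCompletion (maximalIdeal A) A) K₁)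
        (algebraMap A (AdicCompletion (maximalIdeal A) A) y) =
      algebraMap S K₁ ((algebraMap (AdicCompletion (maximalIdeal A) A) S)
        (algebraMap A (AdicCompletion (maximalIdeal A) A) y))
    rw [← IsScalarTower.algebraMap_apply (AdicCompletion (maximalIdeal A) A) S K₁]
  -- `m_A S ⊆ (u₁ ⋯ u_r)`
  have hq' : (maximalIdeal A).map (algebraMap A S) ≤ Ideal.span {∏ j, u j} := by
    rw [Ideal.map_le_iff_le_comap]
    intro a ha
    exact hq a ha
  -- (511): the `fᵢ` in `S`, the independence of their `v̂`-values
  set fS : Fin r → S := fun i => (γ i : S) * ∏ j, u j ^ expo i j with hfSdef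
  have hfS : ∀ i, ι (f i) = algebraMap S K₁ (fS i) := fun i => hf i
  have hfS0 : ∀ i, fS i ≠ 0 := fun i =>
    mul_ne_zero (γ i).ne_zero (Finset.prod_ne_zero_iff.mpr fun j _ => pow_ne_zero _ (hu0 j))
  have hf0 : ∀ i, f i ≠ 0 := fun i h0 => by
    have h1 : algebraMap S K₁ (fS i) = 0 := by rw [← hfS i, h0, map_zero]
    exact hfS0 i ((map_eq_zero_iff _ hSK₁).mp h1)
  have hindS : ∀ n : Fin r → ℤ,
      ∏ i, O'.valuation (algebraMap S K₁ (fS i)) ^ n i = 1 → n = 0 := by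
    have H := (forall_prod_zpow_valuation_eq_one_iff_of_comap O' O hO f hf0).mp hind
    intro n hn
    refine H n ?_
    simp_rw [hιK, hfS]
    exact hn
  have hS1 : ∀ s : S, O'.valuation (algebraMap S K₁ s) ≤ 1 := fun s =>
    (O'.valuation_le_one_iff _).mpr (hSO' s)
  obtain ⟨a, ha, mm, c', h511, -⟩ :=
    CossartPiltantMonomial.exists_prod_zpow_eq_units_mul_pow hSK₁ O'.valuation hS1 u hu0 fS γ
      expo (fun _ => rfl) hindS
  -- the `g_j ∈ K`, `j ≤ r`
  set g : Fin r → K := fun j => ∏ i, f i ^ mm j i with hgdef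
  have hg : ∀ j, algebraMap K K₁ (g j) = algebraMap S K₁ (c' j * u j ^ a) := fun j => by
    rw [← h511 j, hgdef]
    simp only [map_prod, map_zpow₀, hιK, hfS]
  -- (512) by density
  obtain ⟨z, hz, -, c, G, hG⟩ :=
    exists_rsp_powers_of_cp511_of_shape hSK₁ hr u hu0 x hspan hq' a c' g hg bsh ε m hbsh
  -- the end of the proof
  exact exists_adjoin_isRegularLocalRing_of_headData k hP₁ hK₁ ι hι O' halgO' O hO hSK₁ hSO'
    hdomS z hz (fun _ => a) (fun _ => ha) c G fun j => by rw [← hιK]; exact hG j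

end Lemma47State

end Literature.AlgebraicGeometry.Resolution

end
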